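/-
Copyright (c) 2026 the pub-hodgecm-mathlib formalisation cell (harness21).  Prover seat hodgecm-mathlib-F0P3a-p01 (g39), lane A (Unr-K, type U) of the (β₂) road, squad
F0∕P3a ∕ F0∕P3c∕LH4; β₂ WORD #42 leaf ‹LINE-L-A-MIX-HI›: LH7-p09 (g2)'s ★ FILE 12 `…NormFormRayOfTrace` («the norm-form letter is a ray by the trace ideal») RE-PROVED ON TYPE U
WITHOUT the size letter `h2 : |c|·|cc|·|Θα − α| ≤ |ϖE|^m` (false in lane A, `|Θα − α| = 1`); helper lane on h413 = stmt-HodgeConjecture-24833 (count-neutral).  2026-09-05.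
-/
import Summits.HodgeConjecture.HodgeConjecture.Theorems.F0P3cDyRamNormFormRayOfTrace          -- ★ FILE 12 (LH7-p09 (g2)): the lane-B version; brings ★ p861454 `ray_eq_valueSetMod_smul_xPlus`, `ray_subset_normFormSet`, ★ `map_sub_div_eq`, `map_sub_mul_eq`, `isOrd_mul`
import HarnessLib

/-!
# Crux `H413`, line LH4 «(D-RAM) FOUR-FRAME» — the (β₂) road (R-36), (OFF) residue, the MIX band, LANE A (Unr-K, type U): «THE NORM-FORM LETTER IS A RAY BY THE TRACE IDEAL —
# WITHOUT `|Θα − α|`» — ★ FILE 12's `exists_rayPoint_of_trace` ∕ `normFormSet_eq_ray_of_trace` with the letter `h2 : |c|·|cc|·|Θα − α| ≤ |ϖE|^m` REPLACED by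
# `h2′ : |c − ρc|·|cc| ≤ |ϖE|^m`, under the type-U letters `|α − ρα| = 1`, `|ρα − Θα| < 1`, `|2| < 1`

Cell `hodgecm-mathlib` (D-0151), FLOOR 0, crux item H413 = `stmt-HodgeConjecture-24833`, route of record `HCCMUnconditional`; squads F0∕P3a ∕ F0∕P3c∕LH4 ∕ LH7; lane
`--supports stmt-HodgeConjecture-24833 --as helper` (count-neutral; pays NO tier-0 row).  THEOREMS ONLY (no `def`, no instance, no notation, no `sorry`, default heartbeats);
★-only imports; states NO law; (β₂) stays a HYPOTHESIS.  DATUM-LIGHT: ★ FILE 12's letters (`ρ` an isometric involution, `Θ` an isometric involution commuting with `ρ`,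
`Θ ∘ jE = jE ∘ σ`, `Fix ρ = jE(E)`, `jE` isometric, `|α| ≤ 1`, `ρα ≠ α`, an order parameter `cc`, `Y ∈ 𝒪_cc`, a coefficient `c`, the trace bound `|x + σx| ≤ |ϖ|^{d₁}|x|` on `E`)
PLUS the type-U letters `|α − ρα| = 1`, `|ρα − Θα| < 1`, `|2| < 1`.

WHY (LANE-A-BOARD v5 §3(b), this seat).  ★ FILE 12 writes `η = Yζ + jE a = jE p + jE q·α` and expands `N_Θ(η) − pσp = jE(x + σx)·α + jE x·(Θα − α) + jE(qσq)·αΘα`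
(`x = pσq`); its term `jE x·(Θα − α)` needs the SHARP `|Θα − α| ≤ |ϖE|^{d−1}` of the lane-B datum — false in lane A, where `|Θα − α| = 1`.  THE OBSERVATION: type U has a
coordinate generator in the third field `Fix(Θρ)`: `α′ := α·Θ(ρα)` satisfies `Θα′ = ρα′` EXACTLY, `|α′| ≤ 1`, `|α′ − ρα′| = 1` (§0; dyadic: `|α + ρα| = |α − ρα| = 1`).  In the
basis `{1, α′}`: `N_Θ(p + qα′) − pσp = jE x·ρα′ + jE(σx)·α′ + jE(qσq)·α′ρα′`, and under `Tr_ρ` the two cross terms PAIR: `Tr_ρ(c·(…)) = A·jE(x + σx) + (c − ρc)(α′ − ρα′)·jE(σx)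
+ (c + ρc)·jE(qσq)·α′ρα′` with `A = cρα′ + ρc·α′` (`|A| ≤ |c|`).  So the E-trace gain `|x + σx| ≤ |ϖ|^{d₁}|x|` (h1) does the cross term's job, `h3` the square's, and the ONLY new
letter is `h2′ : |c − ρc|·|cc| ≤ |ϖE|^m` — which §3 reads off μ-currency sizes: with `c = μ∕(cc(α − ρα)ΘY)`, `|c − ρc|·|cc| ≤ max(|2|·|μ|∕|Y|, |μ|·|Y − ρY|∕|Y|², |μ − ρμ|∕|Y|)∕|α − ρα|`,
i.e. `g1` (+ `|2| ≤ |ϖE|^{d₁}`), `g2b : |μ|·|cc| ≤ |Y|²·|ϖE|^m∕…`, `g2c : |μ − ρμ| ≤ |α − ρα|·|Y|·|ϖE|^m` — on the lower line (`|Y| = |ϖE|^b`, `m = m⋆`): `m₀ + j ≥ 2b + m⋆`,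
`jl ≥ b + m⋆`, BOTH implied by the K6 floor `4d ≤ N ≤ m₀` on the whole MIX-hi strip `d ≤ b ≤ 2d − 2` (and trivially on the RAY band).
* §0 `exists_thetaRho_fixed_generator` — `∃ α′, Θα′ = ρα′ ∧ |α′| ≤ 1 ∧ |α′ − ρα′| = 1` on type U.
* §1 `exists_rayPoint_of_trace_A` — ★ §1's conclusion VERBATIM from `h1 h2′ h3`; §2 HEAD `normFormSet_eq_ray_of_trace_A` — ★ §2's conclusion VERBATIM.
* §3 `line_letters_of_sizes_A` — `h1 h2′ h3` at `c := μ∕(cc(α − ρα)·ΘY)` from `g1 g2b g2c g3` (+ `ρcc = cc`, `|Y − ρY| ≤ |cc(α − ρα)|`, `|2| ≤ |ϖE|^{d₁}`);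
  HEAD `normFormSet_eq_ray_of_line_sizes_A` — the two combined at `Y := dualGen ρ Θ α cc h_M x₀` (★ FILE 12 §3's HEAD with `g2 ↦ g2b, g2c` + the type-U letters).
HONEST LABEL.  Count-neutral valuation ∕ order algebra; nothing printed is asserted; no census law is stated; ‹LINE-L-A-MIX-HI› stays OPEN; `HC_CM` is proved only modulo the 7 printed
citations (2 remaining named inputs: hLiu418 = `stmt-HodgeConjecture-24832`, h413 = `stmt-HodgeConjecture-24833`) until rung 0 closes.
## References
* [Serre1979] J.-P. Serre, *Local Fields*, GTM 67 (1979): Ch. III §3 Prop. 7 (`Tr 𝔭_E^j = 𝔭_F^{⌊(j+d)∕2⌋}`), Ch. III §6 Prop. 12 (orders of conductor `c`), Ch. V §3 Cor. 3.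
* [Jacobowitz1962] R. Jacobowitz, *Hermitian forms over local fields*, Amer. J. Math. 84 (1962): §4 (duals, gluing).
* [Rogawski1990] J. D. Rogawski, *Automorphic Representations of Unitary Groups in Three Variables*, Ann. of Math. Stud. 123 (1990): §4.9 Prop. 4.9.1 (b) p. 55.
* [Kottwitz1986BaseChangeUnits] R. E. Kottwitz, *Base change for unit elements of Hecke algebras*, Compositio Math. 60 (1986): §1 pp. 240–241.
-/

set_option autoImplicit false

noncomputable section

namespace Summit.HodgeConjecture.HodgeConjecture.Cruxes.H413.F0P3cDyRamNormFormRayOfTraceA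

open scoped Valued WithZero Matrix MatrixGroups
open WithZero
open Literature.NumberTheory.Automorphic Literature.NumberTheory.Automorphic.HermitianLattice Literature.NumberTheory.Automorphic.UnitaryLatticeTree
open Literature.NumberTheory.Rogawski1990
open Summit.HodgeConjecture.HodgeConjecture.Cruxes.H413.F0P3cDyRamFourFramePieces
open Summit.HodgeConjecture.HodgeConjecture.Cruxes.H413.F0P3cDyRamToricCensusDefs
open Summit.HodgeConjecture.HodgeConjecture.Cruxes.H413.F0P3cDyRamShellLineModel (isOrd_mul)
open Summit.HodgeConjecture.HodgeConjecture.Cruxes.H413.F0P3cDyRamDepthScalar (ray_eq_valueSetMod_smul_xPlus ray_subset_normFormSet)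
open Summit.HodgeConjecture.HodgeConjecture.Cruxes.H413.F0P3cDyRamTerminalCellOffShellCardTwo (map_sub_div_eq map_sub_mul_eq)

variable {E M : Type} [Field E] [Valued E ℤᵐ⁰] [Field M] [Valued M ℤᵐ⁰] {ρ Θ : M →+* M} {α : M}

/-! ## §0 The coordinate generator in the third field `Fix(Θρ)` -/

omit [Field E] [Valued E ℤᵐ⁰] in
/-- **TYPE U HAS A GENERATOR WITH `Θα′ = ρα′`**: `ρ, Θ` commuting isometric involutions, `|α| ≤ 1`, `|α − ρα| = 1`, `|ρα − Θα| < 1`, `|2| < 1` ⇒ `α′ := α·Θ(ρα)` has `Θα′ = ρα′`,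
`|α′| ≤ 1`, `|α′ − ρα′| = 1` (`α′ − ρα′ = (α − ρα)(α + ρα) + (α·u − ρα·u′)`, `u = Θ(ρα) − α`, `u′ = Θα − ρα`, `|α + ρα| = |(α − ρα) + 2ρα| = 1`).
[cite: Serre1979, Ch. III §6 Prop. 12; Ch. V §3 Cor. 3] -/
theorem exists_thetaRho_fixed_generator (hρρ : ∀ x, ρ (ρ x) = x) (hvρ : ∀ x, Valued.v (ρ x) = Valued.v x) (hΘΘ : ∀ x, Θ (Θ x) = x)
    (hΘρ : ∀ x, Θ (ρ x) = ρ (Θ x)) (hvΘ : ∀ x, Valued.v (Θ x) = Valued.v x)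
    (hα1 : Valued.v α ≤ 1) (hU : Valued.v (α - ρ α) = 1) (hτ : Valued.v (ρ α - Θ α) < 1) (h2 : Valued.v (2 : M) < 1) :
    ∃ α' : M, Θ α' = ρ α' ∧ Valued.v α' ≤ 1 ∧ Valued.v (α' - ρ α') = 1 := by
  refine ⟨α * Θ (ρ α), ?_, ?_, ?_⟩
  · rw [map_mul, map_mul, hΘΘ, ← hΘρ, hρρ, mul_comm]
  · rw [Valuation.map_mul, hvΘ, hvρ]; exact mul_le_one' hα1 hα1
  · have hρα1 : Valued.v (ρ α) ≤ 1 := by rw [hvρ]; exact hα1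
    have hu : Valued.v (Θ (ρ α) - α) < 1 := by
      rw [show Θ (ρ α) - α = Θ (ρ α - Θ α) by rw [map_sub, hΘΘ], hvΘ]; exact hτ
    have hu' : Valued.v (Θ α - ρ α) < 1 := by rw [Valuation.map_sub_swap]; exact hτ
    have hsum : Valued.v (α + ρ α) = 1 := by
      have e : α + ρ α = (α - ρ α) + 2 * ρ α := by ring
      rw [e, Valuation.map_add_eq_of_lt_left _ (by
        rw [hU, Valuation.map_mul]
        calc Valued.v (2 : M) * Valued.v (ρ α) ≤ Valued.v (2 : M) * 1 := mul_le_mul' le_rfl hρα1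
          _ < 1 := by rw [mul_one]; exact h2), hU]
    have e : α * Θ (ρ α) - ρ (α * Θ (ρ α)) = (α - ρ α) * (α + ρ α) + (α * (Θ (ρ α) - α) - ρ α * (Θ α - ρ α)) := by
      rw [map_mul, ← hΘρ, hρρ]; ring
    rw [e, Valuation.map_add_eq_of_lt_left _ ?_, Valuation.map_mul, hU, hsum, one_mul]
    rw [Valuation.map_mul, hU, hsum, one_mul]
    refine (Valuation.map_sub _ _ _).trans_lt (max_lt ?_ ?_)
    · rw [Valuation.map_mul]
      calc Valued.v α * Valued.v (Θ (ρ α) - α) ≤ 1 * Valued.v (Θ (ρ α) - α) := mul_le_mul' hα1 le_rfl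
        _ < 1 := by rw [one_mul]; exact hu
    · rw [Valuation.map_mul]
      calc Valued.v (ρ α) * Valued.v (Θ α - ρ α) ≤ 1 * Valued.v (Θ α - ρ α) := mul_le_mul' hρα1 le_rfl
        _ < 1 := by rw [one_mul]; exact hu'

/-! ## §1 The value at `(ζ, a)` is `ϖ^m`-close to the ray value at the `Fix ρ`-coordinate of `Yζ + jE a` in the basis `{1, α′}` -/

/-- **EVERY VALUE IS `ϖ^m`-CLOSE TO A RAY VALUE — LANE A** (★ FILE 12 §1's conclusion VERBATIM).  ★ §1's letters with `h2 : |c|·|cc|·|Θα − α| ≤ |ϖE|^m` REPLACED by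
`h2′ : |c − ρc|·|cc| ≤ |ϖE|^m`, plus `Θ` an involution commuting with `ρ` and the type-U letters `|α − ρα| = 1`, `|ρα − Θα| < 1`, `|2| < 1`.  Proof: coordinates in the basis
`{1, α′}` of §0; `Tr_ρ(c·(N_Θ η − pσp)) = A·jE(x + σx) + (c − ρc)(α′ − ρα′)·jE(σx) + (c + ρc)·jE(qσq)·α′ρα′`. [cite: Serre1979, Ch. III §3 Prop. 7; §6 Prop. 12] [cite: Jacobowitz1962, §4] -/
theorem exists_rayPoint_of_trace_A (hρρ : ∀ x, ρ (ρ x) = x) (hvρ : ∀ x, Valued.v (ρ x) = Valued.v x) (hα : ρ α ≠ α) (hα1 : Valued.v α ≤ 1)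
    (hΘΘ : ∀ x, Θ (Θ x) = x) (hΘρ : ∀ x, Θ (ρ x) = ρ (Θ x)) (hvΘ : ∀ x, Valued.v (Θ x) = Valued.v x)
    (hU : Valued.v (α - ρ α) = 1) (hτ : Valued.v (ρ α - Θ α) < 1) (h2 : Valued.v (2 : M) < 1)
    (σ : E →+* E) (hσσ : ∀ x, σ (σ x) = x) (hvσ : ∀ a, Valued.v (σ a) = Valued.v a)
    (jE : E →+* M) (hjiso : ∀ x, Valued.v (jE x) = Valued.v x) (hΘj : ∀ x, Θ (jE x) = jE (σ x)) (hjfix : ∀ z, ρ z = z ↔ ∃ c, jE c = z)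
    {ϖ : E} (hjϖ0 : jE ϖ ≠ 0) {d₁ : ℕ} (htr : ∀ x : E, Valued.v (x + σ x) ≤ Valued.v ϖ ^ d₁ * Valued.v x)
    {cc : M} (hc1 : Valued.v cc ≤ 1) {Y : M} (hYO : IsOrd ρ α cc Y) (c : M) (m : ℕ)
    (h1 : Valued.v c * Valued.v cc * Valued.v (jE ϖ) ^ d₁ ≤ Valued.v (jE ϖ) ^ m)
    (h2' : Valued.v (c - ρ c) * Valued.v cc ≤ Valued.v (jE ϖ) ^ m)
    (h3 : Valued.v c * Valued.v cc * Valued.v cc ≤ Valued.v (jE ϖ) ^ m) :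
    ∀ (ζ : M) (a : E), IsOrd ρ α cc ζ → Valued.v a ≤ 1 → ∃ p : E, Valued.v p ≤ 1 ∧
      Valued.v ((jE ϖ ^ m)⁻¹ * ((c * ((Y * ζ + jE a) * Θ (Y * ζ + jE a)) + ρ (c * ((Y * ζ + jE a) * Θ (Y * ζ + jE a)))) -
        (c * ((Y * 0 + jE p) * Θ (Y * 0 + jE p)) + ρ (c * ((Y * 0 + jE p) * Θ (Y * 0 + jE p)))))) ≤ 1 := by
  intro ζ a hζ ha
  have _hα := hα
  obtain ⟨α', hΘα', hα'1, hU'⟩ := exists_thetaRho_fixed_generator hρρ hvρ hΘΘ hΘρ hvΘ hα1 hU hτ h2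
  have hα'ne : ρ α' ≠ α' := fun h0 => by rw [h0, sub_self, map_zero] at hU'; exact zero_ne_one hU'
  have hpm0 : jE ϖ ^ m ≠ 0 := pow_ne_zero _ hjϖ0
  have hvpmpos : 0 < Valued.v (jE ϖ ^ m) := zero_lt_iff.2 ((Valuation.ne_zero_iff _).2 hpm0)
  have hρj : ∀ e : E, ρ (jE e) = jE e := fun e => (hjfix _).2 ⟨e, rfl⟩
  have hjϖv : Valued.v ϖ = Valued.v (jE ϖ) := (hjiso ϖ).symm
  -- `η = Yζ + jE a ∈ 𝒪_cc` and its `Fix ρ`-coordinates in the basis `{1, α′}`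
  set η : M := Y * ζ + jE a with hηdef
  have hYζ : IsOrd ρ α cc (Y * ζ) := isOrd_mul hvρ hYO hζ
  have hρa : ρ (jE a) = jE a := hρj a
  have hηanti : η - ρ η = Y * ζ - ρ (Y * ζ) := by rw [hηdef, map_add, hρa]; ring
  have hη1 : Valued.v η ≤ 1 := by
    rw [hηdef]
    refine (Valuation.map_add _ _ _).trans (max_le hYζ.1 ?_)
    rw [hjiso]; exact ha
  set q' : M := (η - ρ η) / (α' - ρ α') with hq'def
  set p' : M := η - q' * α' with hp'def
  have hρq' : ρ q' = q' := by rw [hq'def]; exact map_sub_div_eq hρρ η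
  have hρp' : ρ p' = p' := by rw [hp'def, hq'def]; exact map_sub_mul_eq hρρ hα'ne η
  obtain ⟨q, hq⟩ := (hjfix q').1 hρq'
  obtain ⟨p, hp⟩ := (hjfix p').1 hρp'
  have hvq : Valued.v q ≤ Valued.v cc := by
    rw [← hjiso, hq, hq'def, Valuation.map_div, hU', div_one, hηanti]
    exact hYζ.2.trans (le_of_eq (by rw [Valuation.map_mul, hU, mul_one]))
  have hvp : Valued.v p ≤ 1 := by
    rw [← hjiso, hp, hp'def]
    refine (Valuation.map_sub _ _ _).trans (max_le hη1 ?_)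
    rw [Valuation.map_mul, ← hq, hjiso]
    exact mul_le_one' (hvq.trans hc1) hα'1
  have hηpq : η = jE p + jE q * α' := by rw [hp, hq, hp'def]; ring
  refine ⟨p, hvp, ?_⟩
  -- the difference `D` in the coordinates `{1, α′}` (`Θα′ = ρα′`), and its `ρ`-trace
  set x : E := p * σ q with hxdef
  have hD : η * Θ η - jE p * Θ (jE p) = jE x * ρ α' + jE (σ x) * α' + jE (q * σ q) * (α' * ρ α') := by
    rw [hηpq, hxdef]; simp only [map_add, map_mul, hΘj, hσσ, hΘα']; ring
  have e : (c * ((Y * ζ + jE a) * Θ (Y * ζ + jE a)) + ρ (c * ((Y * ζ + jE a) * Θ (Y * ζ + jE a)))) -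
      (c * ((Y * 0 + jE p) * Θ (Y * 0 + jE p)) + ρ (c * ((Y * 0 + jE p) * Θ (Y * 0 + jE p)))) =
      c * (η * Θ η - jE p * Θ (jE p)) + ρ (c * (η * Θ η - jE p * Θ (jE p))) := by
    rw [mul_zero, zero_add, ← hηdef, map_mul ρ c (η * Θ η - jE p * Θ (jE p)), map_sub ρ (η * Θ η), mul_sub, map_mul ρ c, map_mul ρ c]
    ring
  have hTr : c * (η * Θ η - jE p * Θ (jE p)) + ρ (c * (η * Θ η - jE p * Θ (jE p))) =
      (c * ρ α' + ρ c * α') * jE (x + σ x) + (c - ρ c) * (α' - ρ α') * jE (σ x) + (c + ρ c) * (jE (q * σ q) * (α' * ρ α')) := by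
    rw [hD]; simp only [map_add, map_mul, hρj, hρρ]; ring
  -- sizes
  have hvx : Valued.v x ≤ Valued.v cc := by
    rw [hxdef, Valuation.map_mul, hvσ]
    calc Valued.v p * Valued.v q ≤ 1 * Valued.v cc := mul_le_mul' hvp hvq
      _ = Valued.v cc := one_mul _
  have hcρ1 : Valued.v (ρ c) = Valued.v c := hvρ c
  have hρα'1 : Valued.v (ρ α') ≤ 1 := by rw [hvρ]; exact hα'1
  have hA : Valued.v (c * ρ α' + ρ c * α') ≤ Valued.v c := by
    refine (Valuation.map_add _ _ _).trans (max_le ?_ ?_)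
    · rw [Valuation.map_mul]; exact mul_le_of_le_one_right' hρα'1
    · rw [Valuation.map_mul, hcρ1]; exact mul_le_of_le_one_right' hα'1
  have hT1 : Valued.v ((c * ρ α' + ρ c * α') * jE (x + σ x)) ≤ Valued.v (jE ϖ) ^ m := by
    rw [Valuation.map_mul, hjiso]
    calc Valued.v (c * ρ α' + ρ c * α') * Valued.v (x + σ x) ≤ Valued.v c * (Valued.v ϖ ^ d₁ * Valued.v x) := mul_le_mul' hA (htr x)
      _ ≤ Valued.v c * (Valued.v ϖ ^ d₁ * Valued.v cc) := mul_le_mul' le_rfl (mul_le_mul' le_rfl hvx)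
      _ = Valued.v c * Valued.v cc * Valued.v (jE ϖ) ^ d₁ := by rw [hjϖv]; ac_rfl
      _ ≤ Valued.v (jE ϖ) ^ m := h1
  have hT2 : Valued.v ((c - ρ c) * (α' - ρ α') * jE (σ x)) ≤ Valued.v (jE ϖ) ^ m := by
    rw [Valuation.map_mul, Valuation.map_mul, hU', mul_one, hjiso, hvσ]
    exact (mul_le_mul' le_rfl hvx).trans h2'
  have hT3 : Valued.v ((c + ρ c) * (jE (q * σ q) * (α' * ρ α'))) ≤ Valued.v (jE ϖ) ^ m := by
    have hcc' : Valued.v (c + ρ c) ≤ Valued.v c := (Valuation.map_add _ _ _).trans (max_le le_rfl (le_of_eq hcρ1))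
    rw [Valuation.map_mul, Valuation.map_mul, hjiso, Valuation.map_mul, hvσ, Valuation.map_mul]
    calc Valued.v (c + ρ c) * (Valued.v q * Valued.v q * (Valued.v α' * Valued.v (ρ α')))
        ≤ Valued.v c * (Valued.v cc * Valued.v cc * (1 * 1)) :=
          mul_le_mul' hcc' (mul_le_mul' (mul_le_mul' hvq hvq) (mul_le_mul' hα'1 hρα'1))
      _ = Valued.v c * Valued.v cc * Valued.v cc := by rw [mul_one, mul_one, mul_assoc]
      _ ≤ Valued.v (jE ϖ) ^ m := h3
  rw [e, hTr, Valuation.map_mul, map_inv₀, Valuation.map_pow, ← div_eq_inv_mul, div_le_one₀ (by rw [← Valuation.map_pow]; exact hvpmpos)]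
  exact (Valuation.map_add _ _ _).trans (max_le ((Valuation.map_add _ _ _).trans (max_le hT1 hT2)) hT3)

/-! ## §2 HEAD — the norm-form letter is the ray (lane A) -/

/-- **HEAD — «THE NORM-FORM LETTER IS A RAY BY THE TRACE IDEAL».**  Letters of `exists_rayPoint_of_trace` + the sheet-datum letters of ★ p861454 `ray_eq_valueSetMod_smul_xPlus`
(`|ϖ| = exp(−1)`, `|ϖ − σϖ| = |ϖ|^d`, `|jE c| ≤ 1 ↔ |c| ≤ 1`) and the ray scalar `jE e₀ = c + ρc`; lane A: `h2′` for `h2`, plus the type-U letters.  THEN the letter `{z ∣ ∃ ζ a, IsOrd ζ ∧ |a| ≤ 1 ∧ |(ϖE^m)⁻¹(jE z − (c·N_Θ(Yζ + jE a) + ρ(…)))| ≤ 1}`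
EQUALS `valueSetMod σ ϖ m ((e₀·t₊⁻¹) • xPlus σ ϖ d)` — ★ FILE 12 §2's conclusion VERBATIM, from `h1 h2′ h3`.
[cite: Rogawski1990, §4.9 Prop. 4.9.1 (b) p. 55] [cite: Serre1979, Ch. III §3 Prop. 7] [cite: Jacobowitz1962, §4] -/
theorem normFormSet_eq_ray_of_trace_A (hρρ : ∀ x, ρ (ρ x) = x) (hvρ : ∀ x, Valued.v (ρ x) = Valued.v x) (hα : ρ α ≠ α) (hα1 : Valued.v α ≤ 1)
    (hΘΘ : ∀ x, Θ (Θ x) = x) (hΘρ : ∀ x, Θ (ρ x) = ρ (Θ x)) (hvΘ : ∀ x, Valued.v (Θ x) = Valued.v x)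
    (hU : Valued.v (α - ρ α) = 1) (hτ : Valued.v (ρ α - Θ α) < 1) (h2 : Valued.v (2 : M) < 1)
    (σ : E →+* E) (hσσ : ∀ x, σ (σ x) = x) (hvσ : ∀ a, Valued.v (σ a) = Valued.v a)
    {ϖ : E} (hϖ : Valued.v ϖ = exp (-1 : ℤ)) {d : ℕ} (hd : Valued.v (ϖ - σ ϖ) = Valued.v ϖ ^ d)
    (jE : E →+* M) (hjv : ∀ c, Valued.v (jE c) ≤ 1 ↔ Valued.v c ≤ 1) (hjiso : ∀ x, Valued.v (jE x) = Valued.v x)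
    (hΘj : ∀ x, Θ (jE x) = jE (σ x)) (hjfix : ∀ z, ρ z = z ↔ ∃ c, jE c = z)
    {d₁ : ℕ} (htr : ∀ x : E, Valued.v (x + σ x) ≤ Valued.v ϖ ^ d₁ * Valued.v x)
    {cc : M} (hc1 : Valued.v cc ≤ 1) {Y : M} (hYO : IsOrd ρ α cc Y) (c : M) {e₀ : E} (he₀ : jE e₀ = c + ρ c) (m : ℕ)
    (h1 : Valued.v c * Valued.v cc * Valued.v (jE ϖ) ^ d₁ ≤ Valued.v (jE ϖ) ^ m)
    (h2' : Valued.v (c - ρ c) * Valued.v cc ≤ Valued.v (jE ϖ) ^ m)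
    (h3 : Valued.v c * Valued.v cc * Valued.v cc ≤ Valued.v (jE ϖ) ^ m) :
    {z : E | ∃ (ζ : M) (a : E), IsOrd ρ α cc ζ ∧ Valued.v a ≤ 1 ∧
        Valued.v ((jE ϖ ^ m)⁻¹ * (jE z - (c * ((Y * ζ + jE a) * Θ (Y * ζ + jE a)) + ρ (c * ((Y * ζ + jE a) * Θ (Y * ζ + jE a)))))) ≤ 1} =
      valueSetMod σ ϖ m ((e₀ * ((ϖ - σ ϖ) * ((ϖ * σ ϖ) ^ ((d - d % 2) / 2))⁻¹)⁻¹) • xPlus σ ϖ d) := by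
  have hvϖ0 : Valued.v ϖ ≠ 0 := by rw [hϖ]; exact exp_ne_zero
  have hϖ0 : ϖ ≠ 0 := fun h0 => hvϖ0 (by rw [h0, map_zero])
  have hjϖ0 : jE ϖ ≠ 0 := (map_ne_zero jE).2 hϖ0
  rw [← ray_eq_valueSetMod_smul_xPlus σ hvσ hϖ hd jE hjv hΘj hjfix c Y he₀ m]
  refine Set.Subset.antisymm ?_ (ray_subset_normFormSet (ρ := ρ) (α := α) jE ϖ m cc c Y)
  rintro z ⟨ζ, a, hζ, ha, hz⟩
  obtain ⟨p, hp, hsmall⟩ := exists_rayPoint_of_trace_A hρρ hvρ hα hα1 hΘΘ hΘρ hvΘ hU hτ h2 σ hσσ hvσ jE hjiso hΘj hjfix hjϖ0 htr hc1 hYO c m h1 h2' h3 ζ a hζ ha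
  refine ⟨p, hp, ?_⟩
  have e : (jE ϖ ^ m)⁻¹ * (jE z - (c * ((Y * 0 + jE p) * Θ (Y * 0 + jE p)) + ρ (c * ((Y * 0 + jE p) * Θ (Y * 0 + jE p))))) =
      (jE ϖ ^ m)⁻¹ * (jE z - (c * ((Y * ζ + jE a) * Θ (Y * ζ + jE a)) + ρ (c * ((Y * ζ + jE a) * Θ (Y * ζ + jE a))))) +
        (jE ϖ ^ m)⁻¹ * ((c * ((Y * ζ + jE a) * Θ (Y * ζ + jE a)) + ρ (c * ((Y * ζ + jE a) * Θ (Y * ζ + jE a)))) -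
          (c * ((Y * 0 + jE p) * Θ (Y * 0 + jE p)) + ρ (c * ((Y * 0 + jE p) * Θ (Y * 0 + jE p))))) := by ring
  rw [e]
  exact (Valuation.map_add _ _ _).trans (max_le hz hsmall)

/-! ## §3 The three letters from the μ-currency sizes, lane A -/

omit [Valued E ℤᵐ⁰] in
/-- **THE THREE LETTERS FROM SIZES, LANE A.**  `c = μ∕(cc(α − ρα)·ΘY)` with `|ΘY| = |Y| = |ϖE|^b`, `cc(α − ρα) ≠ 0`, `ρcc = cc`, `|Y − ρY| ≤ |cc(α − ρα)|` (`Y ∈ 𝒪_cc`), `|2| ≤ |ϖE|^{d₁}`;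
sizes `g1 : |μ|·|ϖE|^{d₁} ≤ |α − ρα|·|ϖE|^b·|ϖE|^m`, `g2b : |μ|·|cc| ≤ |ϖE|^b·|ϖE|^b·|ϖE|^m`, `g2c : |μ − ρμ| ≤ |α − ρα|·|ϖE|^b·|ϖE|^m`, `g3 : |μ|·|cc| ≤ |α − ρα|·|ϖE|^b·|ϖE|^m`.
THEN `h1 h2′ h3` of §1–§2 hold for `c` (`(c − ρc)·cc(α − ρα)·ΘY·Θ(ρY) = μ·Θ(ρY) + ρμ·ΘY = 2μ·ΘY − μ·Θ(Y − ρY) − (μ − ρμ)·ΘY`). [cite: Serre1979, Ch. III §6 Prop. 12] -/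
theorem line_letters_of_sizes_A (hρρ : ∀ x, ρ (ρ x) = x) (hvρ : ∀ x, Valued.v (ρ x) = Valued.v x) (hΘρ : ∀ x, Θ (ρ x) = ρ (Θ x))
    (hvΘ : ∀ x, Valued.v (Θ x) = Valued.v x) (jE : E →+* M) {ϖ : E}
    {cc Y μ : M} (hc : ρ cc = cc) (hcc : cc * (α - ρ α) ≠ 0) {b : ℕ} (hYb : Valued.v Y = Valued.v (jE ϖ) ^ b) (hY0 : Y ≠ 0)
    (hYρ : Valued.v (Y - ρ Y) ≤ Valued.v (cc * (α - ρ α))) {d₁ m : ℕ} (h2 : Valued.v (2 : M) ≤ Valued.v (jE ϖ) ^ d₁)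
    (g1 : Valued.v μ * Valued.v (jE ϖ) ^ d₁ ≤ Valued.v (α - ρ α) * Valued.v (jE ϖ) ^ b * Valued.v (jE ϖ) ^ m)
    (g2b : Valued.v μ * Valued.v cc ≤ Valued.v (jE ϖ) ^ b * Valued.v (jE ϖ) ^ b * Valued.v (jE ϖ) ^ m)
    (g2c : Valued.v (μ - ρ μ) ≤ Valued.v (α - ρ α) * Valued.v (jE ϖ) ^ b * Valued.v (jE ϖ) ^ m)
    (g3 : Valued.v μ * Valued.v cc ≤ Valued.v (α - ρ α) * Valued.v (jE ϖ) ^ b * Valued.v (jE ϖ) ^ m) :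
    Valued.v (μ / (cc * (α - ρ α) * Θ Y)) * Valued.v cc * Valued.v (jE ϖ) ^ d₁ ≤ Valued.v (jE ϖ) ^ m ∧
      Valued.v (μ / (cc * (α - ρ α) * Θ Y) - ρ (μ / (cc * (α - ρ α) * Θ Y))) * Valued.v cc ≤ Valued.v (jE ϖ) ^ m ∧
      Valued.v (μ / (cc * (α - ρ α) * Θ Y)) * Valued.v cc * Valued.v cc ≤ Valued.v (jE ϖ) ^ m := by
  have hc0 : cc ≠ 0 := fun h0 => hcc (by rw [h0, zero_mul])
  have hvc0 : Valued.v cc ≠ 0 := (Valuation.ne_zero_iff _).2 hc0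
  have hvcpos : 0 < Valued.v cc := zero_lt_iff.2 hvc0
  have hα0 : α - ρ α ≠ 0 := fun h0 => hcc (by rw [h0, mul_zero])
  have hvαpos : 0 < Valued.v (α - ρ α) := zero_lt_iff.2 ((Valuation.ne_zero_iff _).2 hα0)
  have hΘY0 : Θ Y ≠ 0 := (map_ne_zero Θ).2 hY0
  have hΘρY0 : Θ (ρ Y) ≠ 0 := (map_ne_zero Θ).2 ((map_ne_zero ρ).2 hY0)
  have hvYpos : 0 < Valued.v Y := zero_lt_iff.2 ((Valuation.ne_zero_iff _).2 hY0)
  have hvΘY : Valued.v (Θ Y) = Valued.v Y := hvΘ Y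
  have hvΘρY : Valued.v (Θ (ρ Y)) = Valued.v Y := by rw [hvΘ, hvρ]
  -- `|c|·|cc| = |μ| ∕ (|α − ρα|·|Y|)`
  have key : ∀ t : ℤᵐ⁰, Valued.v μ * t ≤ Valued.v (α - ρ α) * Valued.v (jE ϖ) ^ b * Valued.v (jE ϖ) ^ m →
      Valued.v (μ / (cc * (α - ρ α) * Θ Y)) * Valued.v cc * t ≤ Valued.v (jE ϖ) ^ m := fun t ht => by
    have e : Valued.v (μ / (cc * (α - ρ α) * Θ Y)) * Valued.v cc * t = Valued.v μ * t / (Valued.v (α - ρ α) * Valued.v Y) := by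
      rw [Valuation.map_div, Valuation.map_mul, Valuation.map_mul, hvΘ]
      field_simp
    rw [e, div_le_iff₀ (mul_pos hvαpos hvYpos), ← hYb] at *
    calc Valued.v μ * t ≤ Valued.v (α - ρ α) * Valued.v Y * Valued.v (jE ϖ) ^ m := ht
      _ = Valued.v (jE ϖ) ^ m * (Valued.v (α - ρ α) * Valued.v Y) := by ac_rfl
  refine ⟨key _ g1, ?_, key _ g3⟩
  -- `h2′`: the skew of `c`
  have hρB : ρ (cc * (α - ρ α) * Θ Y) = -(cc * (α - ρ α) * Θ (ρ Y)) := by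
    rw [map_mul, map_mul, hc, map_sub, hρρ, ← hΘρ]; ring
  have hskew : (μ / (cc * (α - ρ α) * Θ Y) - ρ (μ / (cc * (α - ρ α) * Θ Y))) * (cc * (α - ρ α) * Θ Y * Θ (ρ Y)) =
      2 * μ * Θ Y - μ * Θ (Y - ρ Y) - (μ - ρ μ) * Θ Y := by
    have hρΘY0 : ρ (Θ Y) ≠ 0 := (map_ne_zero ρ).2 hΘY0
    rw [map_div₀, hρB, map_sub Θ Y, hΘρ]
    field_simp
    ring
  have hS : Valued.v (2 * μ * Θ Y - μ * Θ (Y - ρ Y) - (μ - ρ μ) * Θ Y) ≤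
      max (max (Valued.v (2 : M) * Valued.v μ * Valued.v Y) (Valued.v μ * Valued.v (cc * (α - ρ α)))) (Valued.v (μ - ρ μ) * Valued.v Y) := by
    refine (Valuation.map_sub _ _ _).trans (max_le_max ((Valuation.map_sub _ _ _).trans (max_le_max ?_ ?_)) ?_)
    · rw [Valuation.map_mul, Valuation.map_mul, hvΘY]
    · rw [Valuation.map_mul, hvΘ]; exact mul_le_mul' le_rfl hYρ
    · rw [Valuation.map_mul, hvΘY]
  have hprod : Valued.v (μ / (cc * (α - ρ α) * Θ Y) - ρ (μ / (cc * (α - ρ α) * Θ Y))) * Valued.v cc *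
      (Valued.v (α - ρ α) * Valued.v Y * Valued.v Y) =
      Valued.v (2 * μ * Θ Y - μ * Θ (Y - ρ Y) - (μ - ρ μ) * Θ Y) := by
    rw [← hskew]; simp only [Valuation.map_mul, hvΘY, hvΘρY, mul_assoc, mul_comm, mul_left_comm]
  have hpos : (0 : ℤᵐ⁰) < Valued.v (α - ρ α) * Valued.v Y * Valued.v Y := mul_pos (mul_pos hvαpos hvYpos) hvYpos
  refine le_of_mul_le_mul_right ?_ hpos
  rw [hprod]
  refine hS.trans (max_le (max_le ?_ ?_) ?_)
  · -- `|2|·|μ|·|Y| ≤ |ϖE|^m·|α − ρα|·|Y|²` from `|2| ≤ |ϖE|^{d₁}` and `g1`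
    rw [hYb]
    calc Valued.v (2 : M) * Valued.v μ * Valued.v (jE ϖ) ^ b ≤ Valued.v (jE ϖ) ^ d₁ * Valued.v μ * Valued.v (jE ϖ) ^ b :=
          mul_le_mul' (mul_le_mul' h2 le_rfl) le_rfl
      _ = Valued.v μ * Valued.v (jE ϖ) ^ d₁ * Valued.v (jE ϖ) ^ b := by ac_rfl
      _ ≤ Valued.v (α - ρ α) * Valued.v (jE ϖ) ^ b * Valued.v (jE ϖ) ^ m * Valued.v (jE ϖ) ^ b := mul_le_mul' g1 le_rfl
      _ = Valued.v (jE ϖ) ^ m * (Valued.v (α - ρ α) * Valued.v (jE ϖ) ^ b * Valued.v (jE ϖ) ^ b) := by ac_rfl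
  · -- `|μ|·|cc(α − ρα)| ≤ |ϖE|^m·|α − ρα|·|Y|²` from `g2b`
    rw [hYb, Valuation.map_mul]
    calc Valued.v μ * (Valued.v cc * Valued.v (α - ρ α)) = Valued.v μ * Valued.v cc * Valued.v (α - ρ α) := by ac_rfl
      _ ≤ Valued.v (jE ϖ) ^ b * Valued.v (jE ϖ) ^ b * Valued.v (jE ϖ) ^ m * Valued.v (α - ρ α) := mul_le_mul' g2b le_rfl
      _ = Valued.v (jE ϖ) ^ m * (Valued.v (α - ρ α) * Valued.v (jE ϖ) ^ b * Valued.v (jE ϖ) ^ b) := by ac_rfl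
  · -- `|μ − ρμ|·|Y| ≤ |ϖE|^m·|α − ρα|·|Y|²` from `g2c`
    rw [hYb]
    calc Valued.v (μ - ρ μ) * Valued.v (jE ϖ) ^ b ≤ Valued.v (α - ρ α) * Valued.v (jE ϖ) ^ b * Valued.v (jE ϖ) ^ m * Valued.v (jE ϖ) ^ b :=
          mul_le_mul' g2c le_rfl
      _ = Valued.v (jE ϖ) ^ m * (Valued.v (α - ρ α) * Valued.v (jE ϖ) ^ b * Valued.v (jE ϖ) ^ b) := by ac_rfl

/-- **HEAD — «THE LETTER OF A CONE VERTEX IS A RAY, FROM SIZES» — LANE A (the lower line, MIX-hi and RAY bands).**  ★ FILE 12 §3 HEAD's frame with `g2` REPLACED by `g2b`, `g2c`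
and the extra letters `ρcc = cc`, `|2| ≤ |ϖE|^{d₁}`, `Θ` an involution commuting with `ρ`, `|α − ρα| = 1`, `|ρα − Θα| < 1`, `|2| < 1`; `Y = dualGen ρ Θ α cc h_M x₀ ∈ 𝒪_cc` with
`|Y| = |ϖE|^b`; the ray scalar `jE e₀ = Tr_ρ(μ∕(cc(α − ρα)·ΘY))`.  THEN the norm-form letter over `Λ = x₀·𝒪_cc` IS `valueSetMod σ ϖ m ((e₀·t₊⁻¹) • xPlus σ ϖ d)` — ★'s conclusion VERBATIM.
[cite: Rogawski1990, §4.9 Prop. 4.9.1 (b) p. 55] [cite: Serre1979, Ch. III §3 Prop. 7; Ch. V §3 Cor. 3] [cite: Jacobowitz1962, §4] [cite: Kottwitz1986BaseChangeUnits, §1 pp. 240–241] -/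
theorem normFormSet_eq_ray_of_line_sizes_A (hρρ : ∀ x, ρ (ρ x) = x) (hvρ : ∀ x, Valued.v (ρ x) = Valued.v x) (hα : ρ α ≠ α) (hα1 : Valued.v α ≤ 1)
    (hΘΘ : ∀ x, Θ (Θ x) = x) (hΘρ : ∀ x, Θ (ρ x) = ρ (Θ x)) (hvΘ : ∀ x, Valued.v (Θ x) = Valued.v x)
    (hU : Valued.v (α - ρ α) = 1) (hτ : Valued.v (ρ α - Θ α) < 1) (h2lt : Valued.v (2 : M) < 1)
    (σ : E →+* E) (hσσ : ∀ x, σ (σ x) = x) (hvσ : ∀ a, Valued.v (σ a) = Valued.v a)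
    {ϖ : E} (hϖ : Valued.v ϖ = exp (-1 : ℤ)) {d : ℕ} (hd : Valued.v (ϖ - σ ϖ) = Valued.v ϖ ^ d)
    (jE : E →+* M) (hjv : ∀ c, Valued.v (jE c) ≤ 1 ↔ Valued.v c ≤ 1) (hjiso : ∀ x, Valued.v (jE x) = Valued.v x)
    (hΘj : ∀ x, Θ (jE x) = jE (σ x)) (hjfix : ∀ z, ρ z = z ↔ ∃ c, jE c = z)
    {d₁ : ℕ} (htr : ∀ x : E, Valued.v (x + σ x) ≤ Valued.v ϖ ^ d₁ * Valued.v x) (h2 : Valued.v (2 : M) ≤ Valued.v (jE ϖ) ^ d₁)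
    {cc : M} (hc : ρ cc = cc) (hc1 : Valued.v cc ≤ 1) (hcc : cc * (α - ρ α) ≠ 0) {hM x₀ : M}
    (hYO : IsOrd ρ α cc (dualGen ρ Θ α cc hM x₀)) {b : ℕ} (hYb : Valued.v (dualGen ρ Θ α cc hM x₀) = Valued.v (jE ϖ) ^ b)
    {μ : M} (m : ℕ)
    (g1 : Valued.v μ * Valued.v (jE ϖ) ^ d₁ ≤ Valued.v (α - ρ α) * Valued.v (jE ϖ) ^ b * Valued.v (jE ϖ) ^ m)
    (g2b : Valued.v μ * Valued.v cc ≤ Valued.v (jE ϖ) ^ b * Valued.v (jE ϖ) ^ b * Valued.v (jE ϖ) ^ m)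
    (g2c : Valued.v (μ - ρ μ) ≤ Valued.v (α - ρ α) * Valued.v (jE ϖ) ^ b * Valued.v (jE ϖ) ^ m)
    (g3 : Valued.v μ * Valued.v cc ≤ Valued.v (α - ρ α) * Valued.v (jE ϖ) ^ b * Valued.v (jE ϖ) ^ m)
    {e₀ : E} (he₀ : jE e₀ = μ / (cc * (α - ρ α) * Θ (dualGen ρ Θ α cc hM x₀)) + ρ (μ / (cc * (α - ρ α) * Θ (dualGen ρ Θ α cc hM x₀)))) :
    {z : E | ∃ (ζ : M) (a : E), IsOrd ρ α cc ζ ∧ Valued.v a ≤ 1 ∧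
        Valued.v ((jE ϖ ^ m)⁻¹ * (jE z -
          (μ / (cc * (α - ρ α) * Θ (dualGen ρ Θ α cc hM x₀)) * ((dualGen ρ Θ α cc hM x₀ * ζ + jE a) * Θ (dualGen ρ Θ α cc hM x₀ * ζ + jE a)) +
            ρ (μ / (cc * (α - ρ α) * Θ (dualGen ρ Θ α cc hM x₀)) * ((dualGen ρ Θ α cc hM x₀ * ζ + jE a) * Θ (dualGen ρ Θ α cc hM x₀ * ζ + jE a)))))) ≤ 1} =
      valueSetMod σ ϖ m ((e₀ * ((ϖ - σ ϖ) * ((ϖ * σ ϖ) ^ ((d - d % 2) / 2))⁻¹)⁻¹) • xPlus σ ϖ d) := by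
  have hvϖ0 : Valued.v ϖ ≠ 0 := by rw [hϖ]; exact exp_ne_zero
  have hϖ0 : ϖ ≠ 0 := fun h0 => hvϖ0 (by rw [h0, map_zero])
  have hjϖ0 : jE ϖ ≠ 0 := (map_ne_zero jE).2 hϖ0
  have hY0 : dualGen ρ Θ α cc hM x₀ ≠ 0 := fun h0 => by
    rw [h0, Valuation.map_zero] at hYb
    exact pow_ne_zero b ((Valuation.ne_zero_iff _).2 hjϖ0) hYb.symm
  obtain ⟨h1, h2', h3⟩ := line_letters_of_sizes_A (ρ := ρ) hρρ hvρ hΘρ hvΘ jE hc hcc hYb hY0 hYO.2 h2 g1 g2b g2c g3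
  exact normFormSet_eq_ray_of_trace_A hρρ hvρ hα hα1 hΘΘ hΘρ hvΘ hU hτ h2lt σ hσσ hvσ hϖ hd jE hjv hjiso hΘj hjfix htr hc1 hYO _ he₀ m h1 h2' h3

end Summit.HodgeConjecture.HodgeConjecture.Cruxes.H413.F0P3cDyRamNormFormRayOfTraceA

end
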